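import Summits.RiemannHypothesis.RiemannHypothesis.Theorems.PfPersistenceM2EvenSectorUnconditional
import Summits.RiemannHypothesis.RiemannHypothesis.Theorems.PfPersistenceTwoParityIndexOddLower
import HarnessLib

/-!
# Pf-persistence index route (M2): the FULL real ladder for every `K ∈ ℕ ∪ {∞}`, unconditionally

Long-odds MECHANISM SEARCH (cell `pub-rhpf`, seat M2); every result here is RH-free and makes no
claim about RH.

Notation: `𝒬 = {ρ : ζ(ρ) = 0 non-trivial, Re ρ > 1/2, Im ρ > 0}`, `K = 𝒬.encard ∈ ℕ∞`;
`RealNegIndexAtLeast n a` (M2, `…IndexExact`) = `n` real-valued Weil tests supported in `[-a, a]`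
on whose real span `Re Q` is negative definite (no parity condition).

The cand-7 seat proved the full real ladder for FINITE `K`
(`PfPersistenceParityIndex.exists_realNegIndexAtLeast_iff` /
`….not_realNegIndexAtLeast_succ_iff`, `PfPersistenceTwoParityIndexOddLower.lean`: real index on
long windows `= 2K`), and the upper half for every `K`
(`….le_two_mul_encard_quadrant_of_realNegIndexAtLeast`).  The case `K = ∞` needs no odd test
functions at all: the EVEN negative index is already unbounded there
(`exists_evenNegIndexAtLeast_iff_encard`, unconditional since Ingham's zero-density theorem is a
theorem of the tree), and an even family is a real family (`EvenNegIndexAtLeast.toReal`).  Hence,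
with NO hypothesis and for EVERY `K ∈ ℕ ∪ {∞}`:

* `exists_realNegIndexAtLeast_iff_encard (n) : (∃ a, RealNegIndexAtLeast n a) ↔ n ≤ 2K`;
* `forall_not_realNegIndexAtLeast_succ_iff_encard (n) : (∀ a, ¬ RealNegIndexAtLeast (n+1) a) ↔ 2K ≤ n`
  — level `n + 1` of the full real Weil form is clean at every window iff `2K ≤ n`
  (Bombieri 2000, Thm 8: `2K` negative eigenvalues of the truncated full form — here untruncated,
  window-uniform, both halves, all `K`).

Levels `1, 2` (`n = 0, 1`) are RH; level `3` is `K ≤ 1` (cand-7); nothing here is RH-strength.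
What stays open in the tree: the ODD lower half at `K = ∞` (an odd negative-definite engine with
bystander control; the odd upper half `n ≤ K` holds for every `K`,
`PfPersistenceParityIndex.le_encard_quadrant_of_oddNegIndexAtLeast`).
-/

open Complex Filter Set MeasureTheory
open scoped Real Topology

namespace Summit.RiemannHypothesis.RiemannHypothesis.Theorems.PfPersistenceM2NegIndex

open Literature.NumberTheory.LFunctions
open Literature.NumberTheory.LFunctions.ZetaZeros

/-- `K = ∞` ⟹ the full REAL negative index on long windows is unbounded (via the even sector alone,
unconditional). [cite: Bombieri2000Weil, Thm 8] -/
theorem exists_realNegIndexAtLeast_of_quadrant_infinite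
    (hinf : {ρ : ℂ | ρ ∈ riemannZetaNontrivialZeros ∧ 1 / 2 < ρ.re ∧ 0 < ρ.im}.Infinite) (n : ℕ) :
    ∃ a : ℝ, RealNegIndexAtLeast n a := by
  obtain ⟨a, ha⟩ := (exists_evenNegIndexAtLeast_iff_encard n).2 (by rw [hinf.encard_eq]; exact le_top)
  exact ⟨a, ha.toReal⟩

/-- **The full real ladder, lower + upper half, every `K ∈ ℕ ∪ {∞}` (unconditional, RH-free):**
some window carries real negative index `≥ n` iff `n ≤ 2K`. [cite: Bombieri2000Weil, Thm 8] -/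
theorem exists_realNegIndexAtLeast_iff_encard (n : ℕ) :
    (∃ a : ℝ, RealNegIndexAtLeast n a) ↔
      (n : ℕ∞) ≤ 2 * {ρ : ℂ | ρ ∈ riemannZetaNontrivialZeros ∧ 1 / 2 < ρ.re ∧ 0 < ρ.im}.encard := by
  constructor
  · rintro ⟨a, ha⟩
    exact PfPersistenceParityIndex.le_two_mul_encard_quadrant_of_realNegIndexAtLeast ha
  · intro hn
    by_cases hfin : {ρ : ℂ | ρ ∈ riemannZetaNontrivialZeros ∧ 1 / 2 < ρ.re ∧ 0 < ρ.im}.Finite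
    · rw [hfin.encard_eq_coe_toFinset_card] at hn
      refine (PfPersistenceParityIndex.exists_realNegIndexAtLeast_iff hfin n).2 ?_
      exact_mod_cast hn
    · exact exists_realNegIndexAtLeast_of_quadrant_infinite hfin n

/-- **Level `n + 1` of the FULL real Weil form is clean at every window `⟺ 2K ≤ n`, for every
`K ∈ ℕ ∪ {∞}` (unconditional, RH-free).**  `n = 0, 1`: RH; `n = 2`: `K ≤ 1`; `K = ∞`: every level
eventually goes negative. [cite: Bombieri2000Weil, Thm 8] -/
theorem forall_not_realNegIndexAtLeast_succ_iff_encard (n : ℕ) :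
    (∀ a : ℝ, ¬ RealNegIndexAtLeast (n + 1) a) ↔
      2 * {ρ : ℂ | ρ ∈ riemannZetaNontrivialZeros ∧ 1 / 2 < ρ.re ∧ 0 < ρ.im}.encard ≤ n := by
  constructor
  · intro hno
    by_contra hlt
    have hle : ((n + 1 : ℕ) : ℕ∞) ≤
        2 * {ρ : ℂ | ρ ∈ riemannZetaNontrivialZeros ∧ 1 / 2 < ρ.re ∧ 0 < ρ.im}.encard := by
      rw [Nat.cast_succ]
      exact Order.add_one_le_of_lt (lt_of_not_ge hlt)
    obtain ⟨a, ha⟩ := (exists_realNegIndexAtLeast_iff_encard (n + 1)).2 hle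
    exact hno a ha
  · intro h a
    exact PfPersistenceParityIndex.not_realNegIndexAtLeast_succ_of_two_mul_encard_le h a

/-- `L_n^re ⇒ 2K ≤ n`, unconditional. [cite: Bombieri2000Weil, Thm 8] -/
theorem two_mul_encard_le_of_forall_not_realNegIndexAtLeast (n : ℕ)
    (hno : ∀ a : ℝ, ¬ RealNegIndexAtLeast (n + 1) a) :
    2 * {ρ : ℂ | ρ ∈ riemannZetaNontrivialZeros ∧ 1 / 2 < ρ.re ∧ 0 < ρ.im}.encard ≤ n :=
  (forall_not_realNegIndexAtLeast_succ_iff_encard n).1 hno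

/-- **Parity bookkeeping at every `K`:** a clean real level `n + 1` forces clean EVEN level
`⌊n/2⌋ + 1` and clean ODD level `⌊n/2⌋ + 1` (from `2K ≤ n`: `K ≤ ⌊n/2⌋`), for every `K ∈ ℕ ∪ {∞}`,
unconditionally. [cite: Bombieri2000Weil, Thm 9] -/
theorem forall_not_even_and_odd_of_forall_not_realNegIndexAtLeast (n : ℕ)
    (hno : ∀ a : ℝ, ¬ RealNegIndexAtLeast (n + 1) a) (a : ℝ) :
    ¬ EvenNegIndexAtLeast (n / 2 + 1) a ∧
      ¬ PfPersistenceParityIndex.OddNegIndexAtLeast (n / 2 + 1) a := by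
  have h2K := two_mul_encard_le_of_forall_not_realNegIndexAtLeast n hno
  have hK : {ρ : ℂ | ρ ∈ riemannZetaNontrivialZeros ∧ 1 / 2 < ρ.re ∧ 0 < ρ.im}.encard ≤ (n / 2 : ℕ) := by
    by_cases hfin : {ρ : ℂ | ρ ∈ riemannZetaNontrivialZeros ∧ 1 / 2 < ρ.re ∧ 0 < ρ.im}.Finite
    · rw [hfin.encard_eq_coe_toFinset_card] at h2K ⊢
      have h : 2 * hfin.toFinset.card ≤ n := by exact_mod_cast h2K
      exact_mod_cast (by omega : hfin.toFinset.card ≤ n / 2)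
    · rw [Set.Infinite.encard_eq hfin, ENat.mul_top (by norm_num)] at h2K
      exact absurd h2K (not_le.2 (ENat.coe_lt_top n))
  exact ⟨(forall_not_evenNegIndexAtLeast_succ_iff_encard (n / 2)).2 hK a,
    PfPersistenceParityIndex.not_oddNegIndexAtLeast_succ_of_encard_le hK a⟩

end Summit.RiemannHypothesis.RiemannHypothesis.Theorems.PfPersistenceM2NegIndex
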